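import Literature.AlgebraicGeometry.Resolution.AffineBlowupRegular
import Literature.AlgebraicGeometry.Resolution.AffineBlowupCartier
import HarnessLib

/-!
# The exceptional divisor of the blowing up along a quasi-regular centre with regular quotient is regular

Topic: `Literature/AlgebraicGeometry/Resolution`. PROVED over the tree (`AffineBlowup.lean`,
`AffineBlowupCartier.lean`: `Bl_I(Spec R) = Proj R[It]`, its charts `D₊(bt) = Spec (R[It])_{(bt)}`
and the exceptional ideal sheaf `I·𝒪_{Bl}`, principal generated by `b/1` on `D₊(bt)`;
`BlowupChartQuasiRegular.lean`: `(R[It])_{(x_i t)} ⧸ (x_i) ≅ (R ⧸ I)[T_j : j ≠ i]` for a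
quasi-regular sequence `x`, `I = (x)`): for a **quasi-regular** sequence `x = (x_1, …, x_r)` in a
ring `R` with `R/(x)` a **regular ring**, the exceptional divisor
`E = V(I·𝒪) ⊆ Bl_{(x)}(Spec R)` (Mathlib's closed subscheme `IdealSheafData.subscheme` of the
exceptional ideal) is a **regular scheme**. Indeed `E` is covered by its affine pieces over the
charts `D₊(x_i t)`, which are the affine spaces `Spec (R/I)[T_j : j ≠ i]` over the centre — this
is the chartwise content of

  Liu, *Algebraic Geometry and Arithmetic Curves*, Thm. 8.1.19 (b): for the blowing up
  `π : X̃ → X` of a regular locally Noetherian scheme along a regular closed subscheme `Y`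
  "the scheme `E := π⁻¹(Y)` is a projective bundle `ℙ(C_{Y/X})` of rank `codim(Y, X) − 1` over `Y`"

(PDF p. 383 of the held copy; we prove regularity of `E` and record the chartwise
affine-space structure, not the global `Proj` of the conormal algebra). No regularity of `R` is
needed.

* `isRegularRing_blowupChart_quotient_exceptional` — `(R[It])_{(x_i t)} ⧸ (x_i)` is a regular
  ring;
* `affineBlowup.nonempty_ringEquiv_exceptional_chartOpen` — the ring of the affine piece of `E`
  over `D₊(x_i t)` is `(R[It])_{(x_i t)} ⧸ (x_i)`;
* `affineBlowup.isRegular_exceptional_of_isQuasiRegular` — **`E` is a regular scheme**.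

## Sources

* Q. Liu, *Algebraic Geometry and Arithmetic Curves*, OUP 2002, §8.1, Thm. 1.19 (b)
  (PDF p. 383). [Liu2002]
* U. Görtz, T. Wedhorn, *Algebraic Geometry I*, 2nd ed. (2020), Example 13.95 (blowing up a
  regular closed point: exceptional divisor `≅ ℙ^{d-1}`).
-/

noncomputable section

open CategoryTheory AlgebraicGeometry Polynomial HomogeneousLocalization TopologicalSpace

namespace Literature.AlgebraicGeometry.Resolution

universe u

variable {R : Type u} [CommRing R] {r : ℕ} (x : Fin r → R) (i : Fin r)

local notation3 "𝓘" => Ideal.span (Set.range x)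

/-- **On the chart `D₊(x_i t)` the exceptional divisor is the affine space
`Spec (R/I)[T_j : j ≠ i]`, the spectrum of a regular ring when `R/I` is regular** (for `x`
quasi-regular: `nonempty_ringEquiv_mvPolynomial_quotient_chart` and the regularity of polynomial
rings over regular rings). [cite: Liu2002, Thm. 8.1.19 (b)] -/
theorem isRegularRing_blowupChart_quotient_exceptional (hx : IsQuasiRegular x)
    [IsRegularRing (R ⧸ 𝓘)] :
    IsRegularRing (HomogeneousLocalization.Away (reesGrading 𝓘)
      (reesT (x i) (Ideal.mem_span_range_self (f := x) (x := i))) ⧸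
      Ideal.span {reesChartBase (I := 𝓘) (x i) (Ideal.mem_span_range_self (f := x) (x := i)) (x i)}) := by
  obtain ⟨e⟩ := nonempty_ringEquiv_mvPolynomial_quotient_chart x i hx
  exact IsRegularRing.of_ringEquiv e

variable {x i}

/-- For `b ∈ I`, the ring of the affine piece of the exceptional divisor `E = V(I·𝒪_{Bl})` over
the chart `D₊(bt)` (the piece `Spec (Γ(Bl, D₊(bt)) ⧸ (I·𝒪)(D₊(bt)))` of Mathlib's
`subschemeCover`) is `(R[It])_{(bt)} ⧸ (b/1)`: on the chart the exceptional ideal is generated by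
`b/1` (`map_reesChartBase_eq`). [cite: StacksProject, Tag 02OS] -/
theorem affineBlowup.nonempty_ringEquiv_exceptional_chartOpen {I : Ideal R} (b : R) (hb : b ∈ I) :
    Nonempty ((Γ(affineBlowup I, affineBlowup.chartOpen (I := I) b hb) ⧸
      (affineBlowup.exceptionalIdeal I).ideal (affineBlowup.chartOpen b hb)) ≃+*
      (Away (reesGrading I) (reesT b hb) ⧸ Ideal.span {reesChartBase b hb b})) := by
  -- notation, as in `affineBlowup.exceptionalIdeal_chartOpen`
  let B := Away (reesGrading I) (reesT b hb)
  let j := affineBlowup.chartι (I := I) b hb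
  let K := affineBlowup.exceptionalIdeal I
  let ε : Γ(Spec (.of B), ⊤) ≅ CommRingCat.of B := Scheme.ΓSpecIso (.of B)
  let g₀ : Γ(Spec (.of B), ⊤) := ε.inv.hom (reesChartBase b hb b)
  -- the top ideal of the pulled-back exceptional ideal is `(g₀)`
  have h2 : (K.comap j).ideal ⟨⊤, isAffineOpen_top _⟩ = Ideal.span {g₀} := by
    rw [affineBlowup.exceptionalIdeal_comap_chartι, ideal_ofIdealTop_top, map_reesChartBase_eq,
      Ideal.map_span, Set.image_singleton]
  -- upstairs through `Γ(Bl, j '' ⊤) ≅ Γ(Spec B, ⊤)`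
  let e : Γ(affineBlowup I, affineBlowup.chartOpen (I := I) b hb) ≃+* Γ(Spec (.of B), ⊤) :=
    (j.appIso ⊤).commRingCatIsoToRingEquiv
  have h3 : ((K.ideal (affineBlowup.chartOpen b hb)).comap e.symm.toRingHom) = Ideal.span {g₀} := by
    rw [← h2]
    exact (Scheme.IdealSheafData.ideal_comap_of_isOpenImmersion K j ⟨⊤, isAffineOpen_top _⟩).symm
  have h4 : K.ideal (affineBlowup.chartOpen b hb) = (Ideal.span {g₀}).comap e.toRingHom := by
    rw [← h3, Ideal.comap_comap]
    convert (Ideal.comap_id _).symm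
    ext a
    exact e.symm_apply_apply a
  -- and down to `B` through `Γ(Spec B, ⊤) ≅ B`
  let ε' : Γ(Spec (.of B), ⊤) ≃+* B := ε.commRingCatIsoToRingEquiv
  have hg₀ : ε' g₀ = reesChartBase b hb b := by
    change (ε.inv ≫ ε.hom).hom (reesChartBase b hb b) = _
    rw [ε.inv_hom_id]
    rfl
  let E : Γ(affineBlowup I, affineBlowup.chartOpen (I := I) b hb) ≃+* B := e.trans ε'
  have h5 : Ideal.span {reesChartBase b hb b} =
      (K.ideal (affineBlowup.chartOpen b hb)).map
        (E : Γ(affineBlowup I, affineBlowup.chartOpen (I := I) b hb) →+* B) := by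
    rw [h4, comap_span_singleton_ringEquiv e g₀, Ideal.map_span, Set.image_singleton]
    change _ = Ideal.span {ε' (e (e.symm g₀))}
    rw [e.apply_symm_apply, hg₀]
  exact ⟨Ideal.quotientEquiv _ _ E h5⟩

/-- **The exceptional divisor of `Bl_{(x)}(Spec R)` is a regular scheme** when `x` is
quasi-regular and `R/(x)` is a regular ring (no regularity of `R` needed): the closed subscheme
`E = V(I·𝒪)` of `Bl_I(Spec R)` (`affineBlowup.exceptionalIdeal`, Mathlib's `subscheme`) is
covered by its affine pieces over the charts `D₊(x_i t)` (which cover the blowing up,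
`affineBlowup.iSup_basicOpen_reesT_generators_eq_top`), spectra of
`(R[It])_{(x_i t)} ⧸ (x_i) ≅ (R/I)[T_j : j ≠ i]` — chart by chart an affine space over the centre
(Liu, Thm. 8.1.19 (b): the exceptional divisor is a projective bundle over the centre).
[cite: Liu2002, Thm. 8.1.19 (b)] -/
theorem affineBlowup.isRegular_exceptional_of_isQuasiRegular (hx : IsQuasiRegular x)
    [IsRegularRing (R ⧸ 𝓘)] :
    Scheme.IsRegular (affineBlowup.exceptionalIdeal 𝓘).subscheme := by
  refine Scheme.IsRegular.of_forall_exists_isOpenImmersion fun e' => ?_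
  -- the image of `e'` in `Bl` lies in some chart `D₊(x_i t)`
  have hp : (affineBlowup.exceptionalIdeal 𝓘).subschemeι e' ∈
      (⨆ i : Fin r, Proj.basicOpen (reesGrading 𝓘)
        (reesT (x i) (Ideal.mem_span_range_self (f := x) (x := i)))) := by
    rw [affineBlowup.iSup_basicOpen_reesT_generators_eq_top x]; trivial
  obtain ⟨i, hi⟩ := Opens.mem_iSup.mp hp
  have hb : x i ∈ 𝓘 := Ideal.mem_span_range_self (f := x) (x := i)
  let U : (affineBlowup 𝓘).affineOpens := affineBlowup.chartOpen (I := 𝓘) (x i) hb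
  have hiU : (affineBlowup.exceptionalIdeal 𝓘).subschemeι e' ∈ (U : (affineBlowup 𝓘).Opens) := by
    change (affineBlowup.exceptionalIdeal 𝓘).subschemeι e' ∈ affineBlowup.chartι (I := 𝓘) (x i) hb ''ᵁ ⊤
    rw [affineBlowup.image_top_chartι]
    exact hi
  -- the affine piece of `E` over the chart is `Spec` of a regular ring
  haveI := isRegularRing_blowupChart_quotient_exceptional x i hx
  obtain ⟨eU⟩ := affineBlowup.nonempty_ringEquiv_exceptional_chartOpen (I := 𝓘) (x i) hb
  haveI : IsRegularRing (Γ(affineBlowup 𝓘, (U : (affineBlowup 𝓘).Opens)) ⧸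
      (affineBlowup.exceptionalIdeal 𝓘).ideal U) := IsRegularRing.of_ringEquiv eU.symm
  have hreg : Scheme.IsRegular (Spec ((affineBlowup.exceptionalIdeal 𝓘).subschemeCover.X U)) :=
    Scheme.isRegular_Spec (.of (Γ(affineBlowup 𝓘, (U : (affineBlowup 𝓘).Opens)) ⧸
      (affineBlowup.exceptionalIdeal 𝓘).ideal U))
  refine ⟨_, (affineBlowup.exceptionalIdeal 𝓘).subschemeCover.f U, inferInstance, ?_, hreg⟩
  rw [← Scheme.Hom.coe_opensRange, Scheme.IdealSheafData.opensRange_subschemeCover_map]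
  exact hiU

/-- The same for an `R`-sequence `x` (Rees: `R`-sequences are quasi-regular). [cite: Liu2002, Thm. 8.1.19 (b)] -/
theorem affineBlowup.isRegular_exceptional_of_isWeaklyRegular
    (hx : RingTheory.Sequence.IsWeaklyRegular R (List.ofFn x)) [IsRegularRing (R ⧸ 𝓘)] :
    Scheme.IsRegular (affineBlowup.exceptionalIdeal 𝓘).subscheme :=
  affineBlowup.isRegular_exceptional_of_isQuasiRegular (isQuasiRegular_of_isWeaklyRegular x hx)

end Literature.AlgebraicGeometry.Resolution

end
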